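import Literature.NumberTheory.EllipticCurves.KubertTateSixteen
import Literature.NumberTheory.EllipticCurves.PastenValuationProductMestreOesterleProofs
import HarnessLib

/-!
# Kubert (1976), no rational point of order `16`: the rational points of `X₁(16)` and the leaf
# `n = 16` of Mazur's First reduction

Topic `NumberTheory/EllipticCurves`; a PROOFS file (theorems only, no `def`, no named fact), the
arithmetic half of `Literature.NumberTheory.EllipticCurves.KubertTateSixteen`, which maps a
rational point of order `16` on any Weierstrass cubic over a field with `2 ≠ 0` to a point `(x, y)`
of the genus-`2` curve

  `C₁₆ : y² = x(x² + 1)(x² + 2x - 1)`     (`= X₁(16)`, Sutherland / Bruin–Najman, in the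
                                           coordinate `x = (1 - u)/(1 + u)`)

with `x ∉ {0, 1, -1}`. Here we PROVE `C₁₆(ℚ) = {∞, (0,0), (1, ±2), (-1, ±2)}` as far as the
`x`-coordinate goes (`X1Sixteen_points`: `x ∈ {0, 1, -1}`) — these are the six rational cusps of
`X₁(16)` — and conclude **`not_exists_addOrderOf_eq_sixteen`**: no elliptic curve (indeed no
Weierstrass cubic) over `ℚ` has a rational point of order `16` (Kubert 1976, Ch. IV: `X₁(16)(ℚ)`
is cuspidal; the case `m = 16` of Mazur's Thm. (7'), one of the nine composite leaves of the
tree's `Mazur1977_reduction_to_primes_of_leaves`). HONEST FRAMING: a leaf of the named fact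
`Mazur1977_reduction_to_primes` is retired; Mazur's theorem itself is not proved here and the
leaves `18, 25, 35, 49` stay open.

## The determination of `C₁₆(ℚ)`: a two-cover descent onto `64A` and `32A`

Write `y² = [x(x² + 1)]·[x² + 2x - 1]`. With `x = m/n` in lowest terms,
`(n³y)² = [n m (m² + n²)]·[m² + 2mn - n²]`, and a common prime of the two brackets divides `2`
(`(m² + 2mn - n²) - (m² + n²) = 2n(m - n)`): precisely, if `m - n` is odd the brackets are coprime,
and if `m - n = 2k` is even (so `m, n` are odd) then `m² + n² = 2(2k² + mn)`,
`m² + 2mn - n² = 2(n² + 4nk + 2k²)` with `n m (2k² + mn)` coprime to `n² + 4nk + 2k²`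
(`isCoprime_descent_of_odd`, `isCoprime_descent_of_even`). Hence (`Int.sq_of_isCoprime`)
`x(x² + 1) = d·w²` with `d ∈ {1, -1, 2, -2}` (`X1Sixteen_sqClass`). The four twists are killed by
two theorems ALREADY in the tree (Mestre–Oesterlé 1989, proof of Thm. 1, part 9; Fermat's descents):
* `d = 1`: `w² = x³ + x` forces `x(x² + 1) = 0` (`MestreOesterle.eq_zero_of_sq_eq_cube_add_self`,
  the curve `64A`), so `x = 0`; `d = -1` is the same after `x ↦ -x`;
* `d = ±2`: `(4w)² = (±2x)³ + 4(±2x)`, and every rational point `(X, Y)` of `Y² = X³ + 4X` has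
  `X ∈ {0, 2}` (`eq_zero_or_eq_two_of_sq_eq_cube_add_four_mul`): its image
  `(Y²/4X², Y(4 - X²)/8X²)` under the dual `2`-isogeny lies on `32A : y² = x³ - x`, whose rational
  points have `y = 0` (`MestreOesterle.eq_zero_of_sq_eq_cube_sub_self`); so `x ∈ {0, ±1}`.
No Mordell–Weil theorem and no new descent engine is used.

## References

* [Kubert1976] D. S. Kubert, *Universal bounds on the torsion of elliptic curves*, Proc. London
  Math. Soc. (3) 33 (1976) 193–237, Ch. IV (`X₁(16)(ℚ)` consists of cusps).
* [Mazur1977] B. Mazur, *Modular curves and the Eisenstein ideal*, Publ. Math. IHÉS 47 (1977),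
  Ch. III §5 p. 156 (First reduction, after Kubert), Thm. (7') p. 35.
* [BruinNajman2017] P. Bruin, F. Najman, Acta Arith. 181 (2017), §2 (equation of `X₁(16)`).
* [MestreOesterle1989] J.-F. Mestre, J. Oesterlé, J. reine angew. Math. 400 (1989), proof of
  Thm. 1, part 9 (the rational points of `32A` and `64A`).

## Design

The generic file carries Mathlib's group law with an arbitrary `[DecidableEq F]`; the leaf is stated
instance-polymorphically (`[inst : DecidableEq ℚ]`) so that it fits the `h`-slot of
`Mazur1977_reduction_to_primes_of_five_leaves` under `open scoped Classical` as well as `ℚ`'s own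
instance. Integer bookkeeping follows `PastenValuationProductMestreOesterleProofs.lean`
(`Rat.mul_den_eq_num`, `Int.sq_of_isCoprime`).
-/

namespace Literature.NumberTheory.EllipticCurves

open _root_.WeierstrassCurve

/-! ### §1. The two elliptic pieces, from the tree's `64A` and `32A` theorems -/

/-- `w² = x³ + x` over `ℚ` forces `x = 0` (the curve `64A` has rational points `O, (0,0)` only;
Mestre–Oesterlé, proof of Thm. 1, part 9 — the tree's `MestreOesterle.eq_zero_of_sq_eq_cube_add_self`
gives `w = 0`). [cite: MestreOesterle1989, §4, proof of Thm. 1, part 9, p. 181] -/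
theorem eq_zero_of_sq_eq_cube_add_self_X {x w : ℚ} (h : w ^ 2 = x ^ 3 + x) : x = 0 := by
  have hw := MestreOesterle.eq_zero_of_sq_eq_cube_add_self h
  rw [hw] at h
  have hx : x * (x ^ 2 + 1) = 0 := by linear_combination -h
  rcases mul_eq_zero.mp hx with h0 | h0
  · exact h0
  · exact absurd h0 (by positivity)

/-- **The rational points of `Y² = X³ + 4X` have `X ∈ {0, 2}`** (they are `O, (0,0), (2, ±4)`).
For `X ≠ 0` the point `(Y²/(4X²), Y(4 - X²)/(8X²))` — the image under the dual of the `2`-isogeny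
`32A → (Y² = X³ + 4X)` — lies on `32A : y² = x³ - x`, all of whose rational points have `y = 0`
(Mestre–Oesterlé, part 9; the tree's `MestreOesterle.eq_zero_of_sq_eq_cube_sub_self`); so
`Y(4 - X²) = 0`, and `Y = 0` or `X = -2` contradict `Y² = X(X² + 4)`, leaving `X = 2`.
[cite: MestreOesterle1989, §4, proof of Thm. 1, part 9, p. 181] -/
theorem eq_zero_or_eq_two_of_sq_eq_cube_add_four_mul {X Y : ℚ} (h : Y ^ 2 = X ^ 3 + 4 * X) :
    X = 0 ∨ X = 2 := by
  by_cases hX : X = 0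
  · exact Or.inl hX
  right
  have hX4 : (4 : ℚ) * X ^ 2 ≠ 0 := mul_ne_zero (by norm_num) (pow_ne_zero 2 hX)
  have hX8 : (8 : ℚ) * X ^ 2 ≠ 0 := mul_ne_zero (by norm_num) (pow_ne_zero 2 hX)
  have key : (Y * (4 - X ^ 2) / (8 * X ^ 2)) ^ 2 =
      (Y ^ 2 / (4 * X ^ 2)) ^ 3 - Y ^ 2 / (4 * X ^ 2) := by
    rw [div_pow, div_pow, div_sub_div _ _ (pow_ne_zero 3 hX4) hX4,
      div_eq_div_iff (pow_ne_zero 2 hX8) (mul_ne_zero (pow_ne_zero 3 hX4) hX4)]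
    linear_combination (-256 * X ^ 6 * Y ^ 2 * (Y ^ 2 + X ^ 3 + 4 * X)) * h
  have h0 := MestreOesterle.eq_zero_of_sq_eq_cube_sub_self key
  rw [div_eq_zero_iff] at h0
  rcases h0 with h0 | h0
  · rcases mul_eq_zero.mp h0 with hY | hX2
    · exfalso
      apply hX
      rw [hY] at h
      have hx : X * (X ^ 2 + 4) = 0 := by linear_combination -h
      rcases mul_eq_zero.mp hx with h1 | h1
      · exact h1
      · exact absurd h1 (by positivity)
    · have h4 : (X - 2) * (X + 2) = 0 := by linear_combination -hX2
      rcases mul_eq_zero.mp h4 with h1 | h1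
      · linear_combination h1
      · exfalso
        rw [show X = -2 by linear_combination h1] at h
        nlinarith [sq_nonneg Y]
  · exact absurd h0 hX8

/-! ### §2. The two-cover descent: `x(x² + 1) = d·w²`, `d ∈ {1, -1, 2, -2}` -/

/-- **The coprimality behind the descent, odd case.** For coprime `m, n` with `m - n` odd, the
integers `n m (m² + n²)` and `m² + 2mn - n²` are coprime: `m² + 2mn - n² = -n² + (m + 2n)m
= m² + (2m - n)n = (m² + n²) + 2n(m - n)`, and `m² + n² = (m - n)² + 2mn` is odd and coprime to
`n` and to `m - n`. (The common-divisor-divides-`2` step of Kubert's treatment of `X₁(16)`.)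
[cite: Kubert1976, Ch. IV (X₁(16))] -/
theorem isCoprime_descent_of_odd {m n : ℤ} (hmn : IsCoprime m n) (hodd : Odd (m - n)) :
    IsCoprime (n * m * (m ^ 2 + n ^ 2)) (m ^ 2 + 2 * m * n - n ^ 2) := by
  -- `V` is coprime to `m` and to `n`
  have cm : IsCoprime (m ^ 2 + 2 * m * n - n ^ 2) m := by
    have h := ((hmn.symm.pow_left (m := 2)).neg_left).add_mul_right_left (m + 2 * n)
    have e : -n ^ 2 + (m + 2 * n) * m = m ^ 2 + 2 * m * n - n ^ 2 := by ring
    rwa [e] at h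
  have cn : IsCoprime (m ^ 2 + 2 * m * n - n ^ 2) n := by
    have h := (hmn.pow_left (m := 2)).add_mul_right_left (2 * m - n)
    have e : m ^ 2 + (2 * m - n) * n = m ^ 2 + 2 * m * n - n ^ 2 := by ring
    rwa [e] at h
  -- `g = m² + n²` is odd, coprime to `n` and to `m - n`, hence to `2n(m - n)` and to `V`
  have hg_odd : Odd (m ^ 2 + n ^ 2) := by
    have e : m ^ 2 + n ^ 2 = (m - n) ^ 2 + 2 * (m * n) := by ring
    rw [e]
    exact (hodd.pow).add_even (even_two_mul _)
  have g2 : IsCoprime (m ^ 2 + n ^ 2) 2 := Int.isCoprime_two_right.mpr hg_odd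
  have gn : IsCoprime (m ^ 2 + n ^ 2) n := by
    have h := (hmn.pow_left (m := 2)).add_mul_left_left n
    have e : m ^ 2 + n * n = m ^ 2 + n ^ 2 := by ring
    rwa [e] at h
  have gmn : IsCoprime (m ^ 2 + n ^ 2) (m - n) := by
    have h2 : IsCoprime 2 (m - n) := Int.isCoprime_two_left.mpr hodd
    have hn : IsCoprime n (m - n) := by
      have h := hmn.symm.add_mul_left_right (-1)
      have e : m + n * (-1) = m - n := by ring
      rwa [e] at h
    have h := ((h2.mul_left (hn.pow_left (m := 2))).add_mul_left_left (m + n))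
    have e : 2 * n ^ 2 + (m - n) * (m + n) = m ^ 2 + n ^ 2 := by ring
    rwa [e] at h
  have cg : IsCoprime (m ^ 2 + n ^ 2) (m ^ 2 + 2 * m * n - n ^ 2) := by
    have h := ((g2.mul_right gn).mul_right gmn).add_mul_left_right 1
    have e : 2 * n * (m - n) + (m ^ 2 + n ^ 2) * 1 = m ^ 2 + 2 * m * n - n ^ 2 := by ring
    rwa [e] at h
  exact (cn.symm.mul_left cm.symm).mul_left cg

/-- **The coprimality behind the descent, even case.** For `n` odd and `k` coprime to `n`, put
`m = n + 2k` (so `m - n = 2k` is even and `m` is odd); then `m² + n² = 2(2k² + mn)`,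
`m² + 2mn - n² = 2(n² + 4nk + 2k²)`, and `n m (2k² + mn)` is coprime to `n² + 4nk + 2k²`
(`= 2k² + (4k + n)n = -2k² + m² = (2k² + mn) + 2nk`, with `2k² + mn` odd).
[cite: Kubert1976, Ch. IV (X₁(16))] -/
theorem isCoprime_descent_of_even {n k : ℤ} (hn : Odd n) (hkn : IsCoprime k n) :
    IsCoprime (n * (n + 2 * k) * (2 * k ^ 2 + (n + 2 * k) * n)) (n ^ 2 + 4 * n * k + 2 * k ^ 2) := by
  have hm : Odd (n + 2 * k) := hn.add_even (even_two_mul k)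
  have h2n : IsCoprime 2 n := Int.isCoprime_two_left.mpr hn
  have h2m : IsCoprime 2 (n + 2 * k) := Int.isCoprime_two_left.mpr hm
  have hkm : IsCoprime k (n + 2 * k) := hkn.add_mul_right_right 2
  have h2k2n : IsCoprime (2 * k ^ 2) n := h2n.mul_left (hkn.pow_left (m := 2))
  -- `V'` is coprime to `n`, to `m = n + 2k`, and to `g' = 2k² + mn`
  have cn : IsCoprime (n ^ 2 + 4 * n * k + 2 * k ^ 2) n := by
    have h := h2k2n.add_mul_right_left (4 * k + n)
    have e : 2 * k ^ 2 + (4 * k + n) * n = n ^ 2 + 4 * n * k + 2 * k ^ 2 := by ring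
    rwa [e] at h
  have cm : IsCoprime (n ^ 2 + 4 * n * k + 2 * k ^ 2) (n + 2 * k) := by
    have h := ((h2m.mul_left (hkm.pow_left (m := 2))).neg_left).add_mul_left_left (n + 2 * k)
    have e : -(2 * k ^ 2) + (n + 2 * k) * (n + 2 * k) = n ^ 2 + 4 * n * k + 2 * k ^ 2 := by ring
    rwa [e] at h
  have hg_odd : Odd (2 * k ^ 2 + (n + 2 * k) * n) := (even_two_mul _).add_odd (hm.mul hn)
  have g2 : IsCoprime (2 * k ^ 2 + (n + 2 * k) * n) 2 := Int.isCoprime_two_right.mpr hg_odd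
  have gn : IsCoprime (2 * k ^ 2 + (n + 2 * k) * n) n := h2k2n.add_mul_right_left (n + 2 * k)
  have gk : IsCoprime (2 * k ^ 2 + (n + 2 * k) * n) k := by
    have h := (hkm.symm.mul_left hkn.symm).add_mul_right_left (2 * k)
    have e : (n + 2 * k) * n + (2 * k) * k = 2 * k ^ 2 + (n + 2 * k) * n := by ring
    rwa [e] at h
  have cg : IsCoprime (2 * k ^ 2 + (n + 2 * k) * n) (n ^ 2 + 4 * n * k + 2 * k ^ 2) := by
    have h := ((g2.mul_right gn).mul_right gk).add_mul_left_right 1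
    have e : 2 * n * k + (2 * k ^ 2 + (n + 2 * k) * n) * 1 = n ^ 2 + 4 * n * k + 2 * k ^ 2 := by
      ring
    rwa [e] at h
  exact (cn.symm.mul_left cm.symm).mul_left cg

/-- **The square class of `n m (m² + n²)`.** If `m, n` are coprime integers and
`n m (m² + n²)(m² + 2mn - n²)` is a square, then `n m (m² + n²) = ±w²` or `±2w²` for an integer
`w` (coprime factors of a square are squares up to sign, `Int.sq_of_isCoprime`, applied to the
coprime pairs of `isCoprime_descent_of_odd` / `isCoprime_descent_of_even`).
[cite: Kubert1976, Ch. IV (X₁(16))] -/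
theorem sq_class_of_sq_eq {m n z : ℤ} (hmn : IsCoprime m n)
    (h : z ^ 2 = n * m * (m ^ 2 + n ^ 2) * (m ^ 2 + 2 * m * n - n ^ 2)) :
    ∃ w : ℤ, n * m * (m ^ 2 + n ^ 2) = w ^ 2 ∨ n * m * (m ^ 2 + n ^ 2) = -w ^ 2 ∨
      n * m * (m ^ 2 + n ^ 2) = 2 * w ^ 2 ∨ n * m * (m ^ 2 + n ^ 2) = -(2 * w ^ 2) := by
  rcases Int.even_or_odd (m - n) with heven | hodd
  · -- `m - n = 2k`: both odd, halve both brackets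
    obtain ⟨k, hk⟩ := heven
    have hm : m = n + 2 * k := by linear_combination hk
    subst hm
    have hn : Odd n := by
      rcases Int.even_or_odd n with hn | hn
      · exfalso
        have h2 : (2 : ℤ) ∣ n := even_iff_two_dvd.mp hn
        have hu := hmn.isUnit_of_dvd' (dvd_add h2 (dvd_mul_right 2 k)) h2
        rw [Int.isUnit_iff] at hu
        omega
      · exact hn
    have hkn : IsCoprime k n := by
      have h' : IsCoprime (2 * k + n * 1) n := by
        have e : 2 * k + n * 1 = n + 2 * k := by ring
        rw [e]
        exact hmn
      exact h'.of_add_mul_left_left.of_mul_left_right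
    have hcop := isCoprime_descent_of_even hn hkn
    -- `z` is even
    have hz : Even z := by
      rw [← Int.even_pow' two_ne_zero, h]
      exact ⟨2 * (n * (n + 2 * k) * (2 * k ^ 2 + (n + 2 * k) * n) *
        (n ^ 2 + 4 * n * k + 2 * k ^ 2)), by ring⟩
    obtain ⟨z₁, hz₁⟩ := hz
    have h' : n * (n + 2 * k) * (2 * k ^ 2 + (n + 2 * k) * n) * (n ^ 2 + 4 * n * k + 2 * k ^ 2)
        = z₁ ^ 2 := by
      apply mul_left_cancel₀ (show (4 : ℤ) ≠ 0 by norm_num)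
      rw [hz₁] at h
      linear_combination -h
    obtain ⟨w, hw | hw⟩ := Int.sq_of_isCoprime hcop h'
    · exact ⟨w, Or.inr <| Or.inr <| Or.inl <| by linear_combination 2 * hw⟩
    · exact ⟨w, Or.inr <| Or.inr <| Or.inr <| by linear_combination 2 * hw⟩
  · have hcop := isCoprime_descent_of_odd hmn hodd
    obtain ⟨w, hw | hw⟩ := Int.sq_of_isCoprime hcop h.symm
    · exact ⟨w, Or.inl hw⟩
    · exact ⟨w, Or.inr <| Or.inl hw⟩

/-- A rational number whose square is an integer is an integer. [folklore] -/
private theorem exists_int_eq_of_sq_eq_intCast₁₆ {t : ℚ} {M : ℤ} (h : t ^ 2 = M) :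
    ∃ z : ℤ, t = z := by
  have hden : (t ^ 2).den = 1 := by rw [h]; exact Rat.den_intCast M
  rw [Rat.den_pow] at hden
  have ht : t.den = 1 := by
    rcases Nat.pow_eq_one.mp hden with h1 | h1
    · exact h1
    · exact absurd h1 two_ne_zero
  exact ⟨t.num, (Rat.coe_int_num_of_den_eq_one ht).symm⟩

/-- `x.num` and `x.den` are coprime integers. [folklore] -/
private theorem isCoprime_num_den₁₆ (x : ℚ) : IsCoprime x.num (x.den : ℤ) := by
  rw [Int.isCoprime_iff_gcd_eq_one, Int.gcd_eq_natAbs]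
  simpa using x.reduced

/-- **Two-cover descent on `C₁₆`.** A rational point of `y² = x(x² + 1)(x² + 2x - 1)` has
`x(x² + 1) = d·w²` with `w ∈ ℚ` and `d ∈ {1, -1, 2, -2}`: clear denominators (`x = m/n`,
`(n³y)² = n m (m² + n²)(m² + 2mn - n²)`) and apply `sq_class_of_sq_eq`.
[cite: Kubert1976, Ch. IV (X₁(16))] -/
theorem X1Sixteen_sqClass {x y : ℚ} (h : y ^ 2 = x * (x ^ 2 + 1) * (x ^ 2 + 2 * x - 1)) :
    ∃ w : ℚ, x * (x ^ 2 + 1) = w ^ 2 ∨ x * (x ^ 2 + 1) = -w ^ 2 ∨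
      x * (x ^ 2 + 1) = 2 * w ^ 2 ∨ x * (x ^ 2 + 1) = -(2 * w ^ 2) := by
  have hxq : x * (x.den : ℚ) = x.num := Rat.mul_den_eq_num x
  have hN : (x.den : ℚ) ≠ 0 := by exact_mod_cast x.den_pos.ne'
  have key : (y * (x.den : ℚ) ^ 3) ^ 2 = ((x.den * x.num * (x.num ^ 2 + (x.den : ℤ) ^ 2) *
      (x.num ^ 2 + 2 * x.num * x.den - (x.den : ℤ) ^ 2) : ℤ) : ℚ) := by
    push_cast
    rw [← hxq]
    linear_combination (x.den : ℚ) ^ 6 * h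
  obtain ⟨z, hz⟩ := exists_int_eq_of_sq_eq_intCast₁₆ key
  rw [hz] at key
  have hint : z ^ 2 = x.den * x.num * (x.num ^ 2 + (x.den : ℤ) ^ 2) *
      (x.num ^ 2 + 2 * x.num * x.den - (x.den : ℤ) ^ 2) := by
    exact_mod_cast key
  have hU : x * (x ^ 2 + 1) = ((x.den * x.num * (x.num ^ 2 + (x.den : ℤ) ^ 2) : ℤ) : ℚ) /
      (x.den : ℚ) ^ 4 := by
    rw [eq_div_iff (pow_ne_zero 4 hN)]
    push_cast
    rw [← hxq]
    ring
  obtain ⟨w, hw | hw | hw | hw⟩ := sq_class_of_sq_eq (isCoprime_num_den₁₆ x) hint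
  · exact ⟨w / (x.den : ℚ) ^ 2, Or.inl <| by rw [hU, hw]; push_cast; ring⟩
  · exact ⟨w / (x.den : ℚ) ^ 2, Or.inr <| Or.inl <| by rw [hU, hw]; push_cast; ring⟩
  · exact ⟨w / (x.den : ℚ) ^ 2, Or.inr <| Or.inr <| Or.inl <| by rw [hU, hw]; push_cast; ring⟩
  · exact ⟨w / (x.den : ℚ) ^ 2, Or.inr <| Or.inr <| Or.inr <| by rw [hU, hw]; push_cast; ring⟩

/-! ### §3. The rational points of `C₁₆ = X₁(16)` and the leaf -/

/-- **`X₁(16)(ℚ)` is cuspidal**: every rational solution of `y² = x(x² + 1)(x² + 2x - 1)` has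
`x ∈ {0, 1, -1}` (the six points `∞, (0, 0), (1, ±2), (-1, ±2)` are the six rational cusps of
`X₁(16)`). Two-cover descent (`X1Sixteen_sqClass`) onto the four twists `x(x² + 1) = d w²`,
`d = ±1, ±2`, each settled by the tree's theorems on `64A` and `32A`
(`eq_zero_of_sq_eq_cube_add_self_X`, `eq_zero_or_eq_two_of_sq_eq_cube_add_four_mul` after
`(X, Y) = (±2x, 4w)`). [cite: Kubert1976, Ch. IV (X₁(16)(ℚ) consists of cusps)] -/
theorem X1Sixteen_points {x y : ℚ} (h : y ^ 2 = x * (x ^ 2 + 1) * (x ^ 2 + 2 * x - 1)) :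
    x = 0 ∨ x = 1 ∨ x = -1 := by
  obtain ⟨w, hw | hw | hw | hw⟩ := X1Sixteen_sqClass h
  · exact Or.inl (eq_zero_of_sq_eq_cube_add_self_X (w := w) (by linear_combination -hw))
  · have h0 := eq_zero_of_sq_eq_cube_add_self_X (x := -x) (w := w) (by linear_combination hw)
    exact Or.inl (neg_eq_zero.mp h0)
  · rcases eq_zero_or_eq_two_of_sq_eq_cube_add_four_mul (X := 2 * x) (Y := 4 * w)
      (by linear_combination (-8) * hw) with h0 | h0
    · exact Or.inl (by linear_combination h0 / 2)
    · exact Or.inr (Or.inl (by linear_combination h0 / 2))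
  · rcases eq_zero_or_eq_two_of_sq_eq_cube_add_four_mul (X := -(2 * x)) (Y := 4 * w)
      (by linear_combination 8 * hw) with h0 | h0
    · exact Or.inl (by linear_combination -h0 / 2)
    · exact Or.inr (Or.inr (by linear_combination -h0 / 2))

/-- **No rational point of order `16` (Kubert 1976; the leaf `n = 16` of Mazur's First
reduction).** For every Weierstrass cubic `V` over `ℚ`, no nonsingular rational point has order
`16` — in particular no elliptic curve over `ℚ` has a rational point of order `16`: such a point
would give a rational point of `X₁(16) : y² = x(x² + 1)(x² + 2x - 1)` with `x ∉ {0, ±1}`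
(`WeierstrassCurve.exists_X1Sixteen_point_of_addOrderOf_eq_sixteen`), contradicting
`X1Sixteen_points`. Stated for an arbitrary `DecidableEq ℚ` instance so as to fit the `h`-slot of
`Mazur1977_reduction_to_primes_of_five_leaves`. [cite: Kubert1976, Ch. IV; Mazur1977, Thm. (7') p. 35, Ch. III §5 p. 156] -/
theorem not_exists_addOrderOf_eq_sixteen [inst : DecidableEq ℚ] (V : WeierstrassCurve ℚ) :
    ¬ ∃ P : V.toAffine.Point, addOrderOf P = 16 := by
  rintro ⟨P, hP⟩
  obtain ⟨x, y, hxy, hx0, hx1, hx2⟩ :=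
    exists_X1Sixteen_point_of_addOrderOf_eq_sixteen two_ne_zero P hP
  rcases X1Sixteen_points hxy with h | h | h
  · exact hx0 h
  · exact hx1 h
  · exact hx2 h

end Literature.NumberTheory.EllipticCurves
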